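import Literature.AlgebraicGeometry.Resolution.SmoothStalksRegular
import Literature.AlgebraicGeometry.Dimension.SmoothRelativeDimensionOfClosedPoints
import Literature.AlgebraicGeometry.Resolution.RegularLocalRingsProofs
import Mathlib.RingTheory.RegularLocalRing.Defs
import HarnessLib

/-!
# Local rings of a scheme smooth of relative dimension `n` over a field at a closed point: regular of dimension `n`, cotangent space of dimension `n`,
# a regular system of parameters of length `n` ([EGAIV4] 17.5.8 (iii); [GortzWedhorn2020] Thm. 6.28; [Matsumura1987] Thms. 14.2–14.3)

Topic `Literature/AlgebraicGeometry/Dimension`; namespace `Literature.AlgebraicGeometry.Dimension`.  THEOREMS ONLY (no definition, no named fact, no instance, no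
notation, no `sorry`).  Cell `hodgecm-mathlib` (D-0151), P6 «MOD programme», L4 DUALS road, pay-down «H1-DIM in characteristic `p`» (B-p04 (g41) memo v4, junction
**(REG)** «`𝒪_{Â,0̂}` is regular local of dimension `g` with a regular system of parameters»; LA4-p05 (g0)).  The `R`-side inputs of the entry point ★
`Literature.Algebra.Homology.finrank_HOne_baseChangeComplex_residueField_eq_finrank_cotangentSpace` and of ★ B2 `FreeComplexDualAcyclic.homComplex_exactAt_of_neg` for
`R := 𝒪_{X,x}`, `X` smooth of relative dimension `n` over a field, `x` closed.  HC_CM is proved only modulo the printed citations until rung 0 closes; count-neutral.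

* regularity of `𝒪_{X,x}` is ★ `Resolution.isRegularLocalRing_stalk_of_smooth_of_field` ([EGAIV4] 17.5.8 (iii)), used by name.
* `ringKrullDim_stalk_eq` restated (★ `ringKrullDim_stalk_eq_of_smoothOfRelativeDimension_of_isClosed`) and **`finrank_cotangentSpace_stalk_eq_of_isClosed`** —
  `dim_{κ(x)} 𝔪_x ⁄ 𝔪_x² = n` at a closed point (Mathlib `IsRegularLocalRing.iff_finrank_cotangentSpace`).
* **`exists_isWeaklyRegular_stalk_of_isClosed`** — a regular (hence weakly regular) sequence `rs` in `𝒪_{X,x}` with `(rs) = 𝔪_x` and `rs.length = n` (★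
  `exists_isRegular_ofList_eq_maximalIdeal`).

## References
* [EGAIV4] A. Grothendieck, *EGA IV₄* (1967), Prop. 17.5.8 (iii).
* [GortzWedhorn2020] U. Görtz, T. Wedhorn, *Algebraic Geometry I*, 2nd ed. (2020), Lemma 6.26, Thm. 6.28.
* [Matsumura1987] H. Matsumura, *Commutative Ring Theory* (1987), Thms. 14.2, 14.3.
-/

set_option autoImplicit false

noncomputable section

universe u

open CategoryTheory AlgebraicGeometry TopologicalSpace IsLocalRing

namespace Literature.AlgebraicGeometry.Dimension

variable {K : Type u} [Field K] {X : Scheme.{u}} (f : X ⟶ Spec (CommRingCat.of K))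

/-- **`dim_{κ(x)} 𝔪_x⁄𝔪_x² = n` at a closed point of a scheme smooth of relative dimension `n` over a field**: the local ring is regular
(★ `isRegularLocalRing_stalk_of_smooth_of_field`) of Krull dimension `n` (★ `ringKrullDim_stalk_eq_of_smoothOfRelativeDimension_of_isClosed`), and for a regular local
ring the cotangent space has dimension the Krull dimension (Mathlib `IsRegularLocalRing.iff_finrank_cotangentSpace`).
[cite: GortzWedhorn2020, Thm. 6.28] [cite: Matsumura1987, Thm. 14.2] -/
theorem finrank_cotangentSpace_stalk_eq_of_isClosed (n : ℕ) [SmoothOfRelativeDimension n f] {x : X} (hx : IsClosed ({x} : Set X)) :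
    Module.finrank (ResidueField (X.presheaf.stalk x)) (CotangentSpace (X.presheaf.stalk x)) = n := by
  haveI : Smooth f := SmoothOfRelativeDimension.smooth n f
  haveI : IsRegularLocalRing (X.presheaf.stalk x) := Resolution.isRegularLocalRing_stalk_of_smooth_of_field f x
  have hdim := ringKrullDim_stalk_eq_of_smoothOfRelativeDimension_of_isClosed f n hx
  have h := (IsRegularLocalRing.iff_finrank_cotangentSpace (R := X.presheaf.stalk x)).mp inferInstance
  rw [hdim] at h
  exact_mod_cast h

/-- **A regular system of parameters at a closed point of a scheme smooth of relative dimension `n` over a field**: a sequence `rs` in `𝒪_{X,x}` which is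
(weakly) regular, generates the maximal ideal, and has length `n` (★ `exists_isRegular_ofList_eq_maximalIdeal` in the regular local ring `𝒪_{X,x}` of dimension
`n`). [cite: Matsumura1987, Thms. 14.2 and 14.3] [cite: GortzWedhorn2020, Thm. 6.28] -/
theorem exists_isWeaklyRegular_stalk_of_isClosed (n : ℕ) [SmoothOfRelativeDimension n f] {x : X} (hx : IsClosed ({x} : Set X)) :
    ∃ rs : List (X.presheaf.stalk x), RingTheory.Sequence.IsWeaklyRegular (X.presheaf.stalk x) rs ∧
      Ideal.ofList rs = maximalIdeal (X.presheaf.stalk x) ∧ rs.length = n := by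
  haveI : Smooth f := SmoothOfRelativeDimension.smooth n f
  haveI : IsRegularLocalRing (X.presheaf.stalk x) := Resolution.isRegularLocalRing_stalk_of_smooth_of_field f x
  obtain ⟨rs, hreg, hspan, hlen⟩ := Resolution.exists_isRegular_ofList_eq_maximalIdeal (X.presheaf.stalk x)
  refine ⟨rs, hreg.toIsWeaklyRegular, hspan, ?_⟩
  rw [ringKrullDim_stalk_eq_of_smoothOfRelativeDimension_of_isClosed f n hx] at hlen
  exact_mod_cast hlen

end Literature.AlgebraicGeometry.Dimension

end
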